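import Summits.QuantumFields.YangMills.Theorems.ParabolicTrajectoryContinuumLimitOnTrajectoryStubOSLegsB_Limit
import Literature.MathematicalPhysics.QuantumFieldTheory.SpeciesTimeReflection

/-!
# Stub `stub_arp : ARPOfRP` (line `two-orbit-synchronisation`, crux stmt-QuantumFields-10522), part A:
# the lattice functional of an observable string and its algebra

First helper file of the stub worker for `stub_arp` (seat c2). The canonical curvature distribution
`curvDistribution r sch k p F` (and every `canonDistribution` of DefsC) is the torus expectation of ONE lattice
observable, the **lattice functional** `lat sch k W F` of a string `W` of (centred) observables against the complex
test function `F`: `(lat W F)(U) = ∑_{x⃗ ∈ box^p} F(a_k x⃗) ∏ᵢ Wᵢ(τ_{xᵢ} Ũ)`, `τ_x = configShift (−x)`, `Ũ` the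
periodic lift. The approximate-reflection-positivity argument is algebra on these functionals; this file
provides the part that needs no plaquette bookkeeping (everything in the sub-namespace `Arp` of the line's
namespace, to keep clear of the sibling stub files):
* `lat`, `cen` (centring by the torus Wilson mean), `curvDistribution_eq_integral_lat`;
* `lat_append` — PRODUCT FORMULA: `lat (W ++ W') (F ⊗ G) = lat W F · lat W' G` for append tensors;
* `lat_expand` — MULTILINEARITY in the string: `Wᵢ = ∑_q Vᵢq` ⟹ `lat W F = ∑_{q⃗} lat (V· q⃗·) F`;
* `lat_sub`, `lat_add`, `lat_sum` — linearity in the test function;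
* `conj_lat` (`conj ∘ lat W F = lat W F̄`), `lat_permTest_const` (relabelling for constant strings),
  `lat_osAdjoint_const` (`lat W (ΘF*) = lat W (conj θF)` for constant strings);
* `sum_boxFun_eq` — sums over `box^p` as sums over the `piFinset` of site strings (for reindexing).
-/

set_option autoImplicit false

open scoped SchwartzMap ComplexConjugate
open MeasureTheory Filter Topology
open Literature.MathematicalPhysics.QuantumFieldTheory Literature.MathematicalPhysics.QuantumLattice
open Literature.MathematicalPhysics.AQFT Literature.Probability.LatticeModels
open Summit.QuantumFields.YangMills.Theses.ParabolicTrajectory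

noncomputable section

namespace Summit.QuantumFields.YangMills.Cruxes.ContinuumLimitOnTrajectory.TwoOrbitSynchronisation

local notation "𝔼" => EuclideanSpace ℝ (Fin 4)

/-- (disambiguation: the gauge-configuration translation of `QuantumLattice`, not the spin one of `LatticeModels`) -/
local notation "cfgShift" => Literature.MathematicalPhysics.QuantumLattice.configShift

namespace Arp

/-! ## §A.1 The lattice functional -/

section Lat

variable {G : Type} [Group G] [MeasurableSpace G]

/-- **The lattice functional of an observable string against a complex test function** at step `k`:
`(lat sch k W F)(U) = ∑_{x⃗ ∈ (box 4 L_k)^p} F(a_k x⃗) ∏ᵢ Wᵢ(τ_{xᵢ} Ũ)`, complex-valued, on the torus configurations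
of side `2L_k+1` (`Ũ = torusLift`, `τ_x = configShift (−x)`). -/
def lat (sch : SpeciesScheme (YMSpecies G)) (k : ℕ) {p : ℕ} (W : Fin p → LGConfig 4 G → ℝ)
    (F : 𝓢((Fin p → 𝔼), ℂ)) (U : GaugeConfig 4 (sch.side k) G) : ℂ :=
  ∑ x : Fin p → ↥(box 4 (sch.L k)), F (fun i => sch.a k • siteToE (↑(x i) : Site 4)) *
    ∏ i, ((W i (cfgShift (-(↑(x i) : Site 4)) (torusLift (sch.side k) U)) : ℝ) : ℂ)

/-- Linearity in the test function: differences. -/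
theorem lat_sub (sch : SpeciesScheme (YMSpecies G)) (k : ℕ) {p : ℕ} (W : Fin p → LGConfig 4 G → ℝ)
    (F F' : 𝓢((Fin p → 𝔼), ℂ)) (U : GaugeConfig 4 (sch.side k) G) :
    lat sch k W (F - F') U = lat sch k W F U - lat sch k W F' U := by
  simp only [lat, sub_apply, sub_mul, Finset.sum_sub_distrib]

/-- Linearity in the test function: sums. -/
theorem lat_add (sch : SpeciesScheme (YMSpecies G)) (k : ℕ) {p : ℕ} (W : Fin p → LGConfig 4 G → ℝ)
    (F F' : 𝓢((Fin p → 𝔼), ℂ)) (U : GaugeConfig 4 (sch.side k) G) :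
    lat sch k W (F + F') U = lat sch k W F U + lat sch k W F' U := by
  simp only [lat, add_apply, add_mul, Finset.sum_add_distrib]

/-- Linearity in the test function: finite sums. -/
theorem lat_sum (sch : SpeciesScheme (YMSpecies G)) (k : ℕ) {p : ℕ} (W : Fin p → LGConfig 4 G → ℝ)
    {ι : Type} (s : Finset ι) (F : ι → 𝓢((Fin p → 𝔼), ℂ)) (U : GaugeConfig 4 (sch.side k) G) :
    lat sch k W (∑ j ∈ s, F j) U = ∑ j ∈ s, lat sch k W (F j) U := by
  classical
  induction s using Finset.induction_on with
  | empty => simp [lat]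
  | insert j s hj ih => rw [Finset.sum_insert hj, Finset.sum_insert hj, lat_add, ih]

/-- **Complex conjugation** acts on the test function only (the observables are real):
`conj (lat W F)(U) = lat W F̄ (U)`. -/
theorem conj_lat (sch : SpeciesScheme (YMSpecies G)) (k : ℕ) {p : ℕ} (W : Fin p → LGConfig 4 G → ℝ)
    (F : 𝓢((Fin p → 𝔼), ℂ)) (U : GaugeConfig 4 (sch.side k) G) :
    conj (lat sch k W F U) = lat sch k W (starTest F) U := by
  simp only [lat, map_sum, map_mul, map_prod, Complex.conj_ofReal, starTest_apply]

/-- **Relabelling** for a constant observable string: permuting the arguments of the test function does not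
change the lattice functional (reindex the box strings). -/
theorem lat_permTest_const (sch : SpeciesScheme (YMSpecies G)) (k : ℕ) {p : ℕ} (W₀ : LGConfig 4 G → ℝ)
    (π : Equiv.Perm (Fin p)) (F : 𝓢((Fin p → 𝔼), ℂ)) (U : GaugeConfig 4 (sch.side k) G) :
    lat sch k (fun _ => W₀) (permTest π F) U = lat sch k (fun _ => W₀) F U := by
  unfold lat
  refine Fintype.sum_equiv (Equiv.arrowCongr π.symm (Equiv.refl _)) _ _ fun x => ?_
  have hx : (Equiv.arrowCongr π.symm (Equiv.refl _)) x = x ∘ π := by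
    funext i; simp [Equiv.arrowCongr_apply]
  rw [hx, permTest_apply]
  congr 1
  exact (Fintype.prod_equiv π _ _ fun i => rfl).symm

/-- `ΘF* = (conj θF)^{rev}`: the OS adjoint is the conjugated reflected test function with reversed arguments. -/
theorem osAdjoint_eq_permTest_starTest_thetaMulti {p : ℕ} (F : 𝓢((Fin p → 𝔼), ℂ)) :
    osAdjoint F = permTest Fin.revPerm (starTest (thetaMulti 4 F)) := by
  ext x
  simp [osAdjoint_apply, permTest_apply, thetaMulti_apply, Function.comp_def]

/-- For a constant observable string the lattice functional of `ΘF*` is that of `conj θF`. -/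
theorem lat_osAdjoint_const (sch : SpeciesScheme (YMSpecies G)) (k : ℕ) {p : ℕ} (W₀ : LGConfig 4 G → ℝ)
    (F : 𝓢((Fin p → 𝔼), ℂ)) (U : GaugeConfig 4 (sch.side k) G) :
    lat sch k (fun _ => W₀) (osAdjoint F) U = lat sch k (fun _ => W₀) (starTest (thetaMulti 4 F)) U := by
  rw [osAdjoint_eq_permTest_starTest_thetaMulti, lat_permTest_const]

/-! ## §A.2 Product formula and multilinearity -/

/-- **Product formula**: for an append tensor `H = F ⊗ G` the lattice functional of the appended string is the
product of the lattice functionals (split the box string `x⃗ ∈ box^{n+m}` into its two halves). -/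
theorem lat_append (sch : SpeciesScheme (YMSpecies G)) (k : ℕ) {n m : ℕ} (W : Fin n → LGConfig 4 G → ℝ)
    (W' : Fin m → LGConfig 4 G → ℝ) {F : 𝓢((Fin n → 𝔼), ℂ)} {G' : 𝓢((Fin m → 𝔼), ℂ)}
    {H : 𝓢((Fin (n + m) → 𝔼), ℂ)} (hH : IsAppendTensorOf H F G') (U : GaugeConfig 4 (sch.side k) G) :
    lat sch k (Fin.append W W') H U = lat sch k W F U * lat sch k W' G' U := by
  unfold lat
  rw [Finset.sum_mul_sum, ← Fintype.sum_prod_type']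
  refine Fintype.sum_equiv (Fin.appendEquiv n m).symm _ _ fun x => ?_
  simp only [Fin.appendEquiv_symm_apply]
  rw [hH, Fin.prod_univ_add]
  simp only [Fin.append_left, Fin.append_right, Function.comp_def]
  ring

/-- **Multilinearity in the observable string**: if every `Wᵢ` is a finite sum `∑_q V i q`, the lattice functional is
the sum over the choice strings `q⃗` of the lattice functionals of the strings `(V i (q⃗ i))ᵢ`. -/
theorem lat_expand (sch : SpeciesScheme (YMSpecies G)) (k : ℕ) {p : ℕ} {Q : Type} [Fintype Q]
    (V : Fin p → Q → LGConfig 4 G → ℝ) {W : Fin p → LGConfig 4 G → ℝ}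
    (hW : ∀ i U', W i U' = ∑ q, V i q U') (F : 𝓢((Fin p → 𝔼), ℂ)) (U : GaugeConfig 4 (sch.side k) G) :
    lat sch k W F U = ∑ q : Fin p → Q, lat sch k (fun i => V i (q i)) F U := by
  unfold lat
  simp only [hW, Complex.ofReal_sum]
  simp_rw [Finset.prod_univ_sum, Fintype.piFinset_univ, Finset.mul_sum]
  exact Finset.sum_comm

/-- A box string as a site string: sums over `(box 4 L)^p` are sums over the `piFinset` of site strings with all
entries in the box (the form in which box strings are translated). -/
theorem sum_boxFun_eq {p L : ℕ} {M : Type} [AddCommMonoid M] (g : (Fin p → Site 4) → M) :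
    ∑ x : Fin p → ↥(box 4 L), g (fun i => (↑(x i) : Site 4)) =
      ∑ y ∈ Fintype.piFinset (fun _ : Fin p => box 4 L), g y := by
  rw [← Finset.sum_coe_sort (Fintype.piFinset fun _ : Fin p => box 4 L) g]
  exact Fintype.sum_equiv
    ((Equiv.subtypePiEquivPi (p := fun (_ : Fin p) (y : Site 4) => y ∈ box 4 L)).symm.trans
      (Equiv.subtypeEquivRight fun f => Fintype.mem_piFinset.symm)) _ _ fun x => rfl

end Lat

/-! ## §A.3 Centring and the canonical curvature distribution -/

section Centred

variable {G : Type} [Group G] [TopologicalSpace G] [IsTopologicalGroup G] [CompactSpace G]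
  [MeasurableSpace G] [BorelSpace G]

/-- **Centring** of an observable of the infinite lattice by its torus Wilson mean at step `k`:
`cen O = O − ⟨O⟩_k`. -/
def cen (r : LatticeRep G) (sch : SpeciesScheme (YMSpecies G)) (k : ℕ) (O : LGConfig 4 G → ℝ) :
    LGConfig 4 G → ℝ :=
  fun V => O V - wilsonTorusMean r.ρ (sch.β k) (sch.L k) O

/-- `cen` unfolded. -/
@[simp] theorem cen_apply (r : LatticeRep G) (sch : SpeciesScheme (YMSpecies G)) (k : ℕ)
    (O : LGConfig 4 G → ℝ) (V : LGConfig 4 G) :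
    cen r sch k O V = O V - wilsonTorusMean r.ρ (sch.β k) (sch.L k) O := rfl

/-- Centring is additive in the observable whenever the torus means add up. -/
theorem cen_finset_sum (r : LatticeRep G) (sch : SpeciesScheme (YMSpecies G)) (k : ℕ) {ι : Type}
    (s : Finset ι) (O : ι → LGConfig 4 G → ℝ)
    (hmean : wilsonTorusMean r.ρ (sch.β k) (sch.L k) (fun V => ∑ q ∈ s, O q V) =
      ∑ q ∈ s, wilsonTorusMean r.ρ (sch.β k) (sch.L k) (O q)) (V : LGConfig 4 G) :
    cen r sch k (fun V => ∑ q ∈ s, O q V) V = ∑ q ∈ s, cen r sch k (O q) V := by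
  simp only [cen_apply, hmean, Finset.sum_sub_distrib]

/-- The centred curvature weight of `…OSLegsA` is the centred curvature read at the translate (the literal unit
weight `(a⁴)⁻¹ a⁴` is `1`). -/
theorem cw_eq_cen (r : LatticeRep G) (sch : SpeciesScheme (YMSpecies G)) (k : ℕ) (x : Site 4)
    (U : GaugeConfig 4 (sch.side k) G) :
    cw r sch k x U = cen r sch k r.curvature.F (cfgShift (-x) (torusLift (sch.side k) U)) := by
  unfold cw
  rw [inv_mul_cancel₀ (pow_ne_zero 4 (sch.a_pos k).ne'), one_mul, cen_apply]

/-- **The canonical curvature distribution is the expectation of a lattice functional**: the constant string of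
centred curvatures against `F`. -/
theorem curvDistribution_eq_integral_lat (r : LatticeRep G) (sch : SpeciesScheme (YMSpecies G)) (k p : ℕ)
    (F : 𝓢((Fin p → 𝔼), ℂ)) :
    curvDistribution r sch k p F = ∫ U, lat sch k (fun _ => cen r sch k r.curvature.F) F U ∂(μW r sch k) := by
  rw [curvDistribution_eq]
  simp only [cw_eq_cen, lat]

end Centred

end Arp

/-- **Registered anchor of this file** (closed form of `lat_append`, for the gate's `--supports` stub check): the
lattice functional of an appended observable string against an append tensor is the product of the two lattice
functionals. -/
theorem arpA_lat_append :
    ∀ {G : Type} [Group G] [MeasurableSpace G] (sch : SpeciesScheme (YMSpecies G)) (k n m : ℕ)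
      (W : Fin n → LGConfig 4 G → ℝ) (W' : Fin m → LGConfig 4 G → ℝ)
      (F : 𝓢((Fin n → EuclideanSpace ℝ (Fin 4)), ℂ)) (G' : 𝓢((Fin m → EuclideanSpace ℝ (Fin 4)), ℂ))
      (H : 𝓢((Fin (n + m) → EuclideanSpace ℝ (Fin 4)), ℂ)), IsAppendTensorOf H F G' →
      ∀ U : GaugeConfig 4 (sch.side k) G,
        Arp.lat sch k (Fin.append W W') H U = Arp.lat sch k W F U * Arp.lat sch k W' G' U := by
  intro G _ _ sch k n m W W' F G' H hH U
  exact Arp.lat_append sch k W W' hH U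

end Summit.QuantumFields.YangMills.Cruxes.ContinuumLimitOnTrajectory.TwoOrbitSynchronisation

end
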